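import Mathlib.CategoryTheory.Whiskering
import Mathlib.CategoryTheory.EqToHom
import Mathlib.Combinatorics.Quiver.Path
import Mathlib.Combinatorics.Quiver.Prefunctor

/-!
# Diagrams of categories, families of homotopies, observables, cores and telecores
# ([AbsTopIII] §0 "Combinatorics"/"Categories" and Definition 3.5 (i)–(iv))

Statements-first typing (D-0014) — here in fact honest DEFINITIONS, the material being pure
category theory — of S. Mochizuki, *Topics in absolute anabelian geometry III*, §0 pp.25–27
(oriented graphs, paths, co-verticial pairs, saturated sets of pairs of paths) and Definition 3.5
(i)–(iv) pp.74–76 (diagrams of categories, families of homotopies, observables, cores, telecores,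
contact structures).  Bib key `MochizukiAbsTopIII2015`; page locators = pages of the kurims
manuscript (lit key `paper:url-5493eb38cbb7`).

Dictionary (text → Mathlib):
* oriented graph `Γ⃗` = `Quiver V` (vertices `V`, an edge `e : a ⟶ b` runs from `a` to `b`);
* path `[γ]` on `Γ⃗` of length `n` = `Quiver.Path a b` (the text's paths are isomorphism classes
  of maps from a finite linear oriented graph — exactly a list of composable edges); `Ω(Γ⃗)` =
  `Σ a b, Path a b`; composite `[γ₂] ∘ [γ₁]` (first `γ₁`, then `γ₂`) = `γ₁.comp γ₂`;
  co-verticial = same endpoints, which the typing `p q : Path a b` enforces;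
* a diagram of categories `𝒟 = (Γ⃗_𝒟, {𝒟_v}, {𝒟_e})` = `DiagramOfCategories V`; the functor
  `𝒟_[γ]` of a path = `DiagramOfCategories.pathFunctor`;
* natural transformations / whiskering = Mathlib `NatTrans`, `Functor.whiskerLeft`,
  `Functor.whiskerRight`.

The observation vertex and the telecore edges of Def 3.5 (iii), (iv) are realised by an explicit
extended quiver `ExtVertex V` (`base v` and `obs`) whose new edges `base v ⟶ obs` and
`obs ⟶ base v` are indexed by families `I, J : V → Type`; an observable has `J = ∅`.

Deliberately NOT here (next file): Def 3.5 (v)–(vi) (1-morphisms, 2-morphisms and equivalences of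
diagrams, vertex-rigidity, edge-rigidity, total rigidity, `Aut(𝒟)`, nexus, totally `□`-rigid, nexus-classes of
self-equivalences), Remark 3.5.1 (discussion), Corollaries 3.6/3.7.
-/

namespace Literature.AnabelianGeometry.AbsoluteAnabelian

open _root_.CategoryTheory _root_.Quiver

universe v u w

/-! ### §0: saturated sets of co-verticial pairs of paths -/

section Saturated

variable {V : Type w} [Quiver.{v} V]

/-- A set `E ⊆ Ω(Γ⃗) × Ω(Γ⃗)` of ordered pairs of **co-verticial** paths (same initial and terminal
vertices — condition (b) of the text, enforced by the typing) is **saturated** if it satisfies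
(a) partial inclusion of the diagonal, (c) transitivity, (d) pre-composition and
(e) post-composition with arbitrary paths.
[cite: MochizukiAbsTopIII2015, Section 0 p.26] -/
structure IsSaturated (E : ∀ ⦃a b : V⦄, Path a b → Path a b → Prop) : Prop where
  refl_left : ∀ ⦃a b : V⦄ ⦃p q : Path a b⦄, E p q → E p p
  refl_right : ∀ ⦃a b : V⦄ ⦃p q : Path a b⦄, E p q → E q q
  trans : ∀ ⦃a b : V⦄ ⦃p q r : Path a b⦄, E p q → E q r → E p r
  precomp : ∀ ⦃a b c : V⦄ ⦃p q : Path a b⦄, E p q → ∀ r : Path c a, E (r.comp p) (r.comp q)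
  postcomp : ∀ ⦃a b c : V⦄ ⦃p q : Path a b⦄, E p q → ∀ r : Path b c, E (p.comp r) (q.comp r)

/-- `E` is **symmetrically saturated**: saturated and (f) reflexive under swapping the pair.
[cite: MochizukiAbsTopIII2015, Section 0 p.26] -/
structure IsSymmSaturated (E : ∀ ⦃a b : V⦄, Path a b → Path a b → Prop) : Prop
    extends IsSaturated E where
  symm : ∀ ⦃a b : V⦄ ⦃p q : Path a b⦄, E p q → E q p

/-- `Covert(Γ⃗)`: the set of ALL co-verticial pairs of paths.
[cite: MochizukiAbsTopIII2015, Section 0 p.26] -/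
def covert : ∀ ⦃a b : V⦄, Path a b → Path a b → Prop := fun _ _ _ _ => True

/-- "The set of all co-verticial pairs of paths … is symmetrically saturated."
[cite: MochizukiAbsTopIII2015, Section 0 pp.26–27] -/
theorem isSymmSaturated_covert : IsSymmSaturated (covert (V := V)) where
  refl_left _ _ _ _ _ := trivial
  refl_right _ _ _ _ _ := trivial
  trans _ _ _ _ _ _ _ := trivial
  precomp _ _ _ _ _ _ _ := trivial
  postcomp _ _ _ _ _ _ _ := trivial
  symm _ _ _ _ _ := trivial

/-- The **saturation** of a set `E₀` of co-verticial pairs: "the smallest saturated subset of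
`Covert(Γ⃗)` containing `E₀`", as an inductive predicate.
[cite: MochizukiAbsTopIII2015, Section 0 p.27] -/
inductive Saturation (E₀ : ∀ ⦃a b : V⦄, Path a b → Path a b → Prop) :
    ∀ ⦃a b : V⦄, Path a b → Path a b → Prop
  | base {a b : V} {p q : Path a b} : E₀ p q → Saturation E₀ p q
  | refl_left {a b : V} {p q : Path a b} : Saturation E₀ p q → Saturation E₀ p p
  | refl_right {a b : V} {p q : Path a b} : Saturation E₀ p q → Saturation E₀ q q
  | trans {a b : V} {p q r : Path a b} : Saturation E₀ p q → Saturation E₀ q r → Saturation E₀ p r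
  | precomp {a b c : V} {p q : Path a b} (r : Path c a) :
      Saturation E₀ p q → Saturation E₀ (r.comp p) (r.comp q)
  | postcomp {a b c : V} {p q : Path a b} (r : Path b c) :
      Saturation E₀ p q → Saturation E₀ (p.comp r) (q.comp r)

/-- The saturation is saturated.
[cite: MochizukiAbsTopIII2015, Section 0 p.27] -/
theorem isSaturated_saturation (E₀ : ∀ ⦃a b : V⦄, Path a b → Path a b → Prop) :
    IsSaturated (Saturation E₀) where
  refl_left _ _ _ _ h := h.refl_left
  refl_right _ _ _ _ h := h.refl_right
  trans _ _ _ _ _ h₁ h₂ := h₁.trans h₂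
  precomp _ _ _ _ _ h r := h.precomp r
  postcomp _ _ _ _ _ h r := h.postcomp r

end Saturated

/-! ### Definition 3.5 (i): diagrams of categories -/

/-- **Def 3.5 (i): a diagram of categories** `𝒟 = (Γ⃗_𝒟, {𝒟_v}, {𝒟_e})`: (a) an oriented graph
`Γ⃗_𝒟` (the quiver `V`), (b) for each vertex `v` a category `𝒟_v`, (c) for each edge
`e : v₁ ⟶ v₂` a functor `𝒟_e : 𝒟_{v₁} ⥤ 𝒟_{v₂}`.
[cite: MochizukiAbsTopIII2015, Definition 3.5 (i) p.74] -/
structure DiagramOfCategories (V : Type w) [Quiver.{v} V] : Type (max w (v+1) (u+1)) where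
  /-- The category `𝒟_v` at the vertex `v` (its type of objects). -/
  obj : V → Type u
  /-- The category structure at each vertex. -/
  [cat : ∀ a : V, Category.{v} (obj a)]
  /-- The functor `𝒟_e` along the edge `e`. -/
  map : ∀ {a b : V}, (a ⟶ b) → obj a ⥤ obj b

attribute [instance] DiagramOfCategories.cat

namespace DiagramOfCategories

variable {V : Type w} [Quiver.{v} V] (D : DiagramOfCategories.{v, u, w} V)

/-- "Any path `[γ]` on `Γ⃗_𝒟` that runs from `v₁` to `v₂` determines — by composing the various
functors `𝒟_e` — a functor `𝒟_[γ] : 𝒟_{v₁} ⥤ 𝒟_{v₂}`."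
[cite: MochizukiAbsTopIII2015, Definition 3.5 (i) pp.74–75] -/
def pathFunctor : ∀ {a b : V}, Path a b → (D.obj a ⥤ D.obj b)
  | _, _, .nil => 𝟭 _
  | _, _, .cons p e => pathFunctor p ⋙ D.map e

/-- `𝒟_[γ]` of the length-zero path is the identity functor.
[cite: MochizukiAbsTopIII2015, Definition 3.5 (i) pp.74–75] -/
@[simp] theorem pathFunctor_nil (a : V) : D.pathFunctor (Path.nil : Path a a) = 𝟭 _ := by
  rw [pathFunctor]

/-- `𝒟_[γ]` of a path extended by an edge.
[cite: MochizukiAbsTopIII2015, Definition 3.5 (i) pp.74–75] -/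
@[simp] theorem pathFunctor_cons {a b c : V} (p : Path a b) (e : b ⟶ c) :
    D.pathFunctor (p.cons e) = D.pathFunctor p ⋙ D.map e := by
  rw [pathFunctor]

/-- `𝒟_[γ₂ ∘ γ₁] = 𝒟_[γ₂] ∘ 𝒟_[γ₁]` (composition of paths gives composition of functors).
[cite: MochizukiAbsTopIII2015, Definition 3.5 (i) pp.74–75] -/
theorem pathFunctor_comp {a b c : V} (p : Path a b) (q : Path b c) :
    D.pathFunctor (p.comp q) = D.pathFunctor p ⋙ D.pathFunctor q := by
  induction q with
  | nil => rw [Path.comp_nil, pathFunctor_nil]; exact (Functor.comp_id _).symm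
  | cons q e ih => rw [Path.comp_cons, pathFunctor_cons, pathFunctor_cons, ih]; rfl

/-! ### Definition 3.5 (ii): families of homotopies -/

/-- **Def 3.5 (ii): a family of homotopies** `ℋ = (E_ℋ, {ζ_ϖ})` on `𝒟`: (a) a saturated set
`E_ℋ` of ordered pairs of co-verticial paths (the boundary set), (b) for each
`ϖ = ([γ₁],[γ₂]) ∈ E_ℋ` a natural transformation `ζ_ϖ : 𝒟_[γ₁] ⟶ 𝒟_[γ₂]` (a homotopy), such that
`ζ_{([γ],[γ])}` is the identity, `ζ_{ϖ''} = ζ_{ϖ'} ∘ ζ_ϖ` for composable pairs, and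
`ζ_{([γ₃]∘[γ₁]∘[γ₄], [γ₃]∘[γ₂]∘[γ₄])} = 𝒟_[γ₃] ∘ ζ_ϖ ∘ 𝒟_[γ₄]` (whiskering; the equality of path
functors `𝒟_[γ₃∘γ₁∘γ₄] = 𝒟_[γ₄] ⋙ 𝒟_[γ₁] ⋙ 𝒟_[γ₃]` is `pathFunctor_comp`, inserted as `eqToHom`).
[cite: MochizukiAbsTopIII2015, Definition 3.5 (ii) p.75] -/
structure HomotopyFamily : Type (max w (v+1) (u+1)) where
  /-- The boundary set `E_ℋ`. -/
  E : ∀ ⦃a b : V⦄, Path a b → Path a b → Prop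
  isSaturated : IsSaturated E
  /-- The homotopy `ζ_ϖ` for `ϖ ∈ E_ℋ`. -/
  η : ∀ ⦃a b : V⦄ ⦃p q : Path a b⦄, E p q → (D.pathFunctor p ⟶ D.pathFunctor q)
  η_refl : ∀ ⦃a b : V⦄ ⦃p : Path a b⦄ (h : E p p), η h = 𝟙 _
  η_trans : ∀ ⦃a b : V⦄ ⦃p q r : Path a b⦄ (h₁ : E p q) (h₂ : E q r),
    η (isSaturated.trans h₁ h₂) = η h₁ ≫ η h₂
  η_whisker : ∀ ⦃a b c d : V⦄ ⦃p q : Path a b⦄ (h : E p q) (r₁ : Path c a) (r₂ : Path b d),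
    η (isSaturated.precomp (isSaturated.postcomp h r₂) r₁) =
      eqToHom (by rw [pathFunctor_comp, pathFunctor_comp]) ≫
        Functor.whiskerLeft (D.pathFunctor r₁) (Functor.whiskerRight (η h) (D.pathFunctor r₂)) ≫
        eqToHom (by rw [pathFunctor_comp, pathFunctor_comp])

/-- Every path occurring in a pair of the boundary set is a **boundary set path**.
[cite: MochizukiAbsTopIII2015, Definition 3.5 (ii) p.75] -/
def HomotopyFamily.IsBoundaryPath (H : D.HomotopyFamily) {a b : V} (p : Path a b) : Prop :=
  ∃ q : Path a b, H.E p q ∨ H.E q p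

/-- `ℋ` is **generated by the homotopies indexed by `E*`** if `E_ℋ` is the saturation of `E*`.
[cite: MochizukiAbsTopIII2015, Definition 3.5 (ii) p.75] -/
def HomotopyFamily.IsGeneratedBy (H : D.HomotopyFamily)
    (E₀ : ∀ ⦃a b : V⦄, Path a b → Path a b → Prop) : Prop :=
  ∀ ⦃a b : V⦄ (p q : Path a b), H.E p q ↔ Saturation E₀ p q

/-- `ℋ` is **symmetric** if `E_ℋ` is symmetrically saturated ("thus every `ζ_ϖ` is an
isomorphism").
[cite: MochizukiAbsTopIII2015, Definition 3.5 (ii) p.75] -/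
def HomotopyFamily.IsSymmetric (H : D.HomotopyFamily) : Prop := IsSymmSaturated H.E

/-- In a symmetric family every homotopy is invertible (its inverse is the homotopy of the
swapped pair).
[cite: MochizukiAbsTopIII2015, Definition 3.5 (ii) p.75] -/
theorem HomotopyFamily.isIso_of_isSymmetric (H : D.HomotopyFamily) (hH : H.IsSymmetric)
    {a b : V} {p q : Path a b} (h : H.E p q) : IsIso (H.η h) := by
  refine ⟨H.η (hH.symm h), ?_, ?_⟩
  · rw [← H.η_trans h (hH.symm h), H.η_refl]
  · rw [← H.η_trans (hH.symm h) h, H.η_refl]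

/-- A collection `{ℋ_ι}` of families of homotopies on `𝒟` is **compatible** if there is one family
`ℋ` with `E_{ℋ_ι} ⊆ E_ℋ` and `ζ^ι_ϖ = ζ_ϖ` for all `ι` and `ϖ ∈ E_{ℋ_ι}`.
[cite: MochizukiAbsTopIII2015, Definition 3.5 (ii) p.75] -/
def HomotopyFamily.Compatible {ι : Type*} (H : ι → D.HomotopyFamily) : Prop :=
  ∃ K : D.HomotopyFamily, ∀ i, ∃ hsub : ∀ ⦃a b : V⦄ ⦃p q : Path a b⦄, (H i).E p q → K.E p q,
    ∀ ⦃a b : V⦄ ⦃p q : Path a b⦄ (h : (H i).E p q), (H i).η h = K.η (hsub h)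

end DiagramOfCategories

/-! ### Definition 3.5 (iii)/(iv): the extended graph with an observation vertex -/

/-- Vertices of the extended oriented graph `Γ⃗_𝒮 ⊇ Γ⃗_𝒟`: the vertices of `Γ⃗_𝒟` and one new
vertex, the **observation vertex** `v_𝒮` (Def 3.5 (iii) (b): "the set of vertices of
`Γ⃗_𝒮 ∖ Γ⃗_𝒟` is equal to `{v_𝒮}`").
[cite: MochizukiAbsTopIII2015, Definition 3.5 (iii) p.75] -/
inductive ExtVertex (V : Type w) : Type w
  | base (v : V) : ExtVertex V
  | obs : ExtVertex V

/-- The shape of an extension: new edges `base v ⟶ obs` indexed by `I v` (observation edges,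
Def 3.5 (iii) (b): "every edge of `Γ⃗_𝒮 ∖ Γ⃗_𝒟` runs from a vertex of `Γ⃗_𝒟` to `v_𝒮`") and new
edges `obs ⟶ base v` indexed by `J v` (telecore edges, Def 3.5 (iv) (a): "every edge of
`Γ⃗_𝒯 ∖ Γ⃗_𝒮` runs from `v_𝒮` to a vertex of `Γ⃗_𝒟`"; `J = ∅` for an observable).
[cite: MochizukiAbsTopIII2015, Definition 3.5 (iii) p.75] -/
structure ExtShape (V : Type w) : Type (max w (v+1)) where
  /-- Observation edges into `v_𝒮` from `v`. -/
  I : V → Type v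
  /-- Telecore edges out of `v_𝒮` to `v`. -/
  J : V → Type v

/-- The vertex type of the extension determined by a shape (a copy of `ExtVertex V` carrying the
shape, so that the quiver instance can depend on it). [folklore] -/
def ExtShape.Vertex {V : Type w} (_X : ExtShape.{v} V) : Type w := ExtVertex V

/-- The old vertex `v` seen in the extended graph. [folklore] -/
def ExtShape.base {V : Type w} (X : ExtShape.{v} V) (a : V) : X.Vertex := ExtVertex.base a

/-- The observation vertex `v_𝒮` of the extended graph. [folklore] -/
def ExtShape.obs {V : Type w} (X : ExtShape.{v} V) : X.Vertex := ExtVertex.obs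

/-- Edges of the extended oriented graph: old edges between old vertices, `I v` from `base v` to
`obs`, `J v` from `obs` to `base v`, no loop at `obs`.
[cite: MochizukiAbsTopIII2015, Definition 3.5 (iii) p.75] -/
def ExtShape.Hom {V : Type w} [Quiver.{v} V] (X : ExtShape.{v} V) :
    X.Vertex → X.Vertex → Type v
  | ExtVertex.base a, ExtVertex.base b => (a ⟶ b)
  | ExtVertex.base a, ExtVertex.obs => X.I a
  | ExtVertex.obs, ExtVertex.base b => X.J b
  | ExtVertex.obs, ExtVertex.obs => PEmpty.{v+1}

/-- The extended oriented graph `Γ⃗_𝒮` (or `Γ⃗_𝒯`) as a quiver.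
[cite: MochizukiAbsTopIII2015, Definition 3.5 (iii) p.75] -/
instance ExtShape.quiver {V : Type w} [Quiver.{v} V] (X : ExtShape.{v} V) :
    Quiver.{v} X.Vertex :=
  ⟨X.Hom⟩

namespace DiagramOfCategories

variable {V : Type w} [Quiver.{v} V] (D : DiagramOfCategories.{v, u, w} V)

/-- The data of an extension of `𝒟` over a shape: the category at the observation vertex and the
functors along the new edges.
[cite: MochizukiAbsTopIII2015, Definition 3.5 (iii) p.75] -/
structure ExtData (X : ExtShape.{v} V) : Type (max w (v+1) (u+1)) where
  /-- The category `𝒮_{v_𝒮}` at the observation vertex. -/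
  S : Type u
  [catS : Category.{v} S]
  /-- Functors `𝒟_v ⥤ 𝒮_{v_𝒮}` along the observation edges. -/
  obsMap : ∀ {a : V}, X.I a → (D.obj a ⥤ S)
  /-- Functors `𝒮_{v_𝒮} ⥤ 𝒟_v` along the telecore edges. -/
  telMap : ∀ {a : V}, X.J a → (S ⥤ D.obj a)

attribute [instance] ExtData.catS

/-- The extended diagram of categories `𝒮` (or `𝒯`) on the extended graph.
[cite: MochizukiAbsTopIII2015, Definition 3.5 (iii) p.75] -/
def extend {X : ExtShape.{v} V} (Y : D.ExtData X) : DiagramOfCategories.{v, u, w} X.Vertex where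
  obj a := match a with
    | ExtVertex.base a => D.obj a
    | ExtVertex.obs => Y.S
  cat a := match a with
    | ExtVertex.base a => D.cat a
    | ExtVertex.obs => Y.catS
  map {a b} e := match a, b, e with
    | ExtVertex.base _, ExtVertex.base _, e => D.map e
    | ExtVertex.base _, ExtVertex.obs, i => Y.obsMap i
    | ExtVertex.obs, ExtVertex.base _, j => Y.telMap j
    | ExtVertex.obs, ExtVertex.obs, e => PEmpty.elim e

/-! ### Definition 3.5 (iii): observables and cores -/

/-- **Def 3.5 (iii): an observable** `𝒮 = (𝒮, v_𝒮, ℋ)` on `𝒟`: (a)/(b) an extension of `𝒟` by one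
observation vertex receiving edges from vertices of `𝒟` (shape with `J = ∅`, i.e. each `J v`
empty), and (c) a family of homotopies `ℋ` on `𝒮` "such that every boundary set path of `ℋ` has
terminal vertex equal to `v_𝒮`".
[cite: MochizukiAbsTopIII2015, Definition 3.5 (iii) p.75] -/
structure Observable : Type (max w (v+1) (u+1)) where
  /-- The shape (observation edges; `J` is required empty). -/
  shape : ExtShape.{v} V
  isEmpty_J : ∀ a : V, IsEmpty (shape.J a)
  /-- Category at `v_𝒮` and functors along the observation edges. -/
  ext : D.ExtData shape
  /-- The family of homotopies on `𝒮`. -/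
  H : (D.extend ext).HomotopyFamily
  terminal_obs : ∀ ⦃a b : shape.Vertex⦄ ⦃p q : Path a b⦄, H.E p q → b = shape.obs

/-- An observable is **symmetric** if its family of homotopies is.
[cite: MochizukiAbsTopIII2015, Definition 3.5 (iii) p.75] -/
def Observable.IsSymmetric (S : D.Observable) : Prop := S.H.IsSymmetric

/-- **Def 3.5 (iii): a core** on `𝒟`: an observable whose boundary set "is equal to the set of all
co-verticial pairs of paths on `Γ⃗_𝒮` with terminal vertex equal to `v_𝒮` [which implies that
`𝒮` is symmetric], and, moreover, every vertex of `Γ⃗_𝒟` appears as the initial vertex of a path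
on `Γ⃗_𝒮` with terminal vertex equal to `v_𝒮`"; `v_𝒮` is then the **core vertex**.
[cite: MochizukiAbsTopIII2015, Definition 3.5 (iii) pp.75–76] -/
structure Observable.IsCore (S : D.Observable) : Prop where
  boundary_all : ∀ ⦃a : S.shape.Vertex⦄ (p q : Path a S.shape.obs), S.H.E p q
  reaches_obs : ∀ a : V, Nonempty (Path (S.shape.base a) S.shape.obs)

/-- A core is symmetric (the text's parenthetical "[which implies that `𝒮` is symmetric]").
[cite: MochizukiAbsTopIII2015, Definition 3.5 (iii) p.75] -/
theorem Observable.IsCore.isSymmetric {S : D.Observable} (hS : S.IsCore) : S.IsSymmetric where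
  toIsSaturated := S.H.isSaturated
  symm a b p q h := by
    obtain rfl := S.terminal_obs h
    exact hS.boundary_all q p

/-! ### Definition 3.5 (iv): telecores and contact structures -/

/-- The inclusion of extended graphs `Γ⃗_𝒮 ↪ Γ⃗_𝒯` when telecore edges are added to an observable
shape (identity on vertices and on old/observation edges). [folklore] -/
def telecoreInclusion (X : ExtShape.{v} V) (hX : ∀ a, IsEmpty (X.J a)) (J : V → Type v) :
    X.Vertex ⥤q (ExtShape.Vertex ⟨X.I, J⟩) where
  obj a := match a with
    | ExtVertex.base a => ExtVertex.base a
    | ExtVertex.obs => ExtVertex.obs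
  map {a b} e := match a, b, e with
    | ExtVertex.base _, ExtVertex.base _, e => e
    | ExtVertex.base _, ExtVertex.obs, i => i
    | ExtVertex.obs, ExtVertex.base b, j => ((hX b).false j).elim
    | ExtVertex.obs, ExtVertex.obs, e => PEmpty.elim e

/-- **Def 3.5 (iv): a telecore** `𝒯 = (𝒯, 𝒥)` on `𝒟` over a core `𝒮`: (a) a diagram `𝒯 ⊇ 𝒮` with the
same vertices whose new edges — the **telecore edges** — run from `v_𝒮` to vertices of `𝒟`
(family `J` with functors `𝒮_{v_𝒮} ⥤ 𝒟_v`), (b) a family of homotopies `𝒥` on `𝒯` restricting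
to `ℋ` on `𝒮`, "whose boundary set is equal to the subset of pairs `([γ₃]∘[γ₁], [γ₃]∘[γ₂])` where
`([γ₁],[γ₂])` is a co-verticial pair of paths on `Γ⃗_𝒯` with terminal vertex `v_𝒮` and `[γ₃]` is a
path on `Γ⃗_𝒯` with initial vertex `v_𝒮`".  The restriction condition `𝒥|_𝒮 = ℋ` is stated on
boundary sets and homotopies along the graph inclusion (the path functors agree by
construction — recorded as the hypothesis `pathFunctor_incl` to avoid transporting along it).
[cite: MochizukiAbsTopIII2015, Definition 3.5 (iv) p.76] -/
structure Telecore (S : D.Observable) (hS : S.IsCore) : Type (max w (v+1) (u+1)) where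
  /-- Telecore edges out of the core vertex. -/
  J : V → Type v
  /-- Functors along the telecore edges. -/
  telMap : ∀ {a : V}, J a → (S.ext.S ⥤ D.obj a)
  /-- The family of homotopies `𝒥` on `𝒯`. -/
  Jfam : (D.extend (X := ⟨S.shape.I, J⟩) ⟨S.ext.S, S.ext.obsMap, telMap⟩).HomotopyFamily
  boundary_iff : ∀ ⦃a b : ExtShape.Vertex ⟨S.shape.I, J⟩⦄ (p q : Path a b),
    Jfam.E p q ↔ ∃ (p₁ q₁ : Path a (ExtShape.obs ⟨S.shape.I, J⟩))
      (r : Path (ExtShape.obs ⟨S.shape.I, J⟩) b), p = p₁.comp r ∧ q = q₁.comp r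
  pathFunctor_incl : ∀ ⦃a b : S.shape.Vertex⦄ (p : Path a b),
    HEq ((D.extend S.ext).pathFunctor p)
      ((D.extend (X := ⟨S.shape.I, J⟩) ⟨S.ext.S, S.ext.obsMap, telMap⟩).pathFunctor
        ((telecoreInclusion S.shape S.isEmpty_J J).mapPath p))
  restrict_E : ∀ ⦃a b : S.shape.Vertex⦄ (p q : Path a b),
    S.H.E p q ↔ Jfam.E ((telecoreInclusion S.shape S.isEmpty_J J).mapPath p)
      ((telecoreInclusion S.shape S.isEmpty_J J).mapPath q)
  restrict_η : ∀ ⦃a b : S.shape.Vertex⦄ (p q : Path a b) (h : S.H.E p q),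
    HEq (S.H.η h) (Jfam.η ((restrict_E p q).mp h))

/-- **Def 3.5 (iv): a contact structure** for the telecore `𝒯`: "a family of homotopies `ℋ_cnct`
on `𝒯` that is compatible with `𝒥`".
[cite: MochizukiAbsTopIII2015, Definition 3.5 (iv) p.76] -/
def Telecore.IsContactStructure {S : D.Observable} {hS : S.IsCore} (T : D.Telecore S hS)
    (Hcnct : (D.extend (X := ⟨S.shape.I, T.J⟩) ⟨S.ext.S, S.ext.obsMap, T.telMap⟩).HomotopyFamily) :
    Prop :=
  HomotopyFamily.Compatible _ (fun b : Bool => if b then Hcnct else T.Jfam)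

end DiagramOfCategories

end Literature.AnabelianGeometry.AbsoluteAnabelian
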